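import Literature.Combinatorics.Optimization.EquivariantPsdStructure
import HarnessLib

/-!
# Psd factorizations equivariant under a subgroup `G ≤ 𝔖ₙ`: the Fawzi–Saunderson–Parrilo structure
# theorem and the index-span bound

Fawzi–Saunderson–Parrilo, *Equivariant semidefinite lifts and sum-of-squares hierarchies*
(arXiv:1312.6662; SIAM J. Optim. 25 (2015)), Theorem 1 (p. 7) / Theorem 4 (p. 10): a `G`-equivariant
psd lift of size `d` of a `G`-orbitope — `G` an ARBITRARY finite group, `ρ : G → GL_d(ℝ)` an ARBITRARY
real representation — yields a `G`-invariant subspace `V` of functions on the vertices, `dim V ≤ d³`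
(`≤ d²` along the square-root route of `EquivariantPsdStructure.lean`), such that every facet slack is a
sum of squares of elements of `V`; Proposition 2 (p. 9): `ρ` may be taken orthogonal after the change of
basis `Q = (Σ_g ρ(g)ρ(g)ᵀ)^{-1/2}`. Braun–Brown-Cohen–Huq–Pokutta–Raghavendra–Roy–Weitz–Zink, *The
matching problem has no small symmetric SDP* (arXiv:1504.00703; Math. Program. 165 (2017)), Lemma 2.3
(p. 5) and Theorem 4.10 (p. 9), work with the subgroup `G = A_n ≤ 𝔖ₙ` and with `ε`-APPROXIMATE
formulations, whose factorization carries the shifted slack `C̃(f) − f = Σ_j h_j² + μ_f`, `μ_f ≥ 0`.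

This file is the subgroup / shifted-slack form of `EquivariantPsdFactorization.lean` +
`EquivariantPsdStructure.lean` (which are hard-wired to `G = 𝔖ₙ` and the exact slack), as typed by the
cell pnp-psdrank (planner p2, `HOME/pnp-psdrank-p2/Sketch-v5-R2full-PROVED.lean`, Lemmas 1–2, ported
verbatim):

* vocabulary `IsSubgroupEquivariantPsdFactorization n d G ε ρ A B` (a `G`-equivariant psd factorization,
  `G ≤ 𝔖ₙ`, `ρ : G →* GL_d(ℝ)`, of the `ε`-shifted odd-cut slack `(U, M) ↦ (|δ(U) ∩ M| − 1) + ε` of the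
  perfect matching polytope of `K_n`), `HasSubgroupEquivariantPsdFactorization`, the AFFINE variant
  `IsSubgroupEquivariantPsdFactorizationAff` (`… = tr(A^M B_U) + μ_U`, `μ_U ≥ 0` — what an `ε`-approximate
  SDP formulation yields without padding), `IsSubgroupInvariant G V`; embedding lemmas from the `𝔖ₙ`
  vocabulary (`G = ⊤`, `ε = 0`);
* **index span** `indexSpan` (Lemma 2): a `G`-invariant subspace lies in an `𝔖ₙ`-invariant one of
  dimension `≤ [𝔖ₙ : G] · dim V` (the sum of its translates over a transversal) — folklore;
* **structure theorem** `subgroupStructureSq` / `subgroupStructureSqAff` (Lemma 1): the proof of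
  `equivariantStructureSq` with the Weyl average taken over `G` (machinery in the sub-namespace
  `SubgroupEquivariantPsdStructure`, names suffixed `G`; the matrix lemmas `sqrt_conj`,
  `trace_mul_mul_eq_sum_sq` are reused from `EquivariantPsdStructure`).

The matching-specific consequences (Theorems A/B, the `2^{αn}` bound for every subgroup of index
`< 2^{αn}`, and the discharge of `BraunEtAl2016_symmetricSDP_matching`) are in
`MatchingSubgroupEquivariantPsdBound.lean`. Deliberately NOT here: a version for an abstract finite group
acting through a homomorphism `G →* 𝔖ₙ` (TODO(general form); the subgroup case is what Braun et al.
Thm. 4.10 and the cell's rung consume).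

## References

* H. Fawzi, J. Saunderson, P. A. Parrilo, arXiv:1312.6662, Def. 2 (p. 3), Thm. 1 (p. 7), Prop. 2 (p. 9),
  Thm. 4 and the proof of Thm. 1 (pp. 10–11). [FawziSaundersonParrilo2013]
* G. Braun, J. Brown-Cohen, A. Huq, S. Pokutta, P. Raghavendra, A. Roy, B. Weitz, D. Zink,
  arXiv:1504.00703, Def. 2.2 and Lemma 2.3 (p. 5), Thm. 4.10 (p. 9). [BraunEtAl2016]
-/

noncomputable section

open Finset Matrix

namespace Literature.Combinatorics.Optimization

open Literature.Barriers.PneNP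

/-! ### Vocabulary: `G`-equivariant psd factorizations of the shifted odd-cut slack -/

/-- `(ρ, A, B)` is a **`G`-equivariant psd factorization of size `d`** (`G ≤ 𝔖ₙ` a subgroup,
`ρ : G → GL_d(ℝ)` an arbitrary real representation) of the **`ε`-shifted** odd-cut slack matrix
`(U, M) ↦ (|δ(U) ∩ M| − 1) + ε` of the perfect matching polytope of `K_n`: `A(M) ⪰ 0` on perfect
matchings, `B(U) ⪰ 0` on odd vertex sets, `pmSlack U M + ε = tr(A(M) B(U))`, and
`A(σ·M) = ρ(σ) A(M) ρ(σ)ᵀ` for `σ ∈ G`. Only `A`-side (matching-side) equivariance, exactly as in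
`IsEquivariantPsdFactorization` (the case `G = 𝔖ₙ`, `ε = 0`). Braun et al. Thm. 4.10 is the case
`G = A_n`, `ρ` by coordinate permutations, `0 ≤ ε < 1`.
[cite: FawziSaundersonParrilo2013, Def. 2 (p. 3) and Thm. 4 (p. 10)] [cite: BraunEtAl2016, Def. 2.2 and Lemma 2.3 (p. 5)] -/
def IsSubgroupEquivariantPsdFactorization (n d : ℕ) (G : Subgroup (Equiv.Perm (Fin n))) (ε : ℝ)
    (ρ : G →* GL (Fin d) ℝ) (A : Finset (Sym2 (Fin n)) → Matrix (Fin d) (Fin d) ℝ)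
    (B : Finset (Fin n) → Matrix (Fin d) (Fin d) ℝ) : Prop :=
  (∀ M, IsPMOn univ M → (A M).PosSemidef) ∧
  (∀ U, Odd U.card → (B U).PosSemidef) ∧
  (∀ U M, Odd U.card → IsPMOn univ M → pmSlack U M + ε = (A M * B U).trace) ∧
  (∀ σ : G, ∀ M, IsPMOn univ M →
    A (permEdges (σ : Equiv.Perm (Fin n)) M) =
      (ρ σ : Matrix (Fin d) (Fin d) ℝ) * A M * (ρ σ : Matrix (Fin d) (Fin d) ℝ)ᵀ)

/-- The `ε`-shifted odd-cut slack matrix of `P_PM(K_n)` **has** a `G`-equivariant psd factorization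
of size `d`. [cite: FawziSaundersonParrilo2013, Def. 2 (p. 3)] -/
def HasSubgroupEquivariantPsdFactorization (n d : ℕ) (G : Subgroup (Equiv.Perm (Fin n))) (ε : ℝ) :
    Prop :=
  ∃ (ρ : G →* GL (Fin d) ℝ) (A : Finset (Sym2 (Fin n)) → Matrix (Fin d) (Fin d) ℝ)
    (B : Finset (Fin n) → Matrix (Fin d) (Fin d) ℝ), IsSubgroupEquivariantPsdFactorization n d G ε ρ A B

/-- **Affine variant** of `IsSubgroupEquivariantPsdFactorization` — what the SDP factorization
theorem (Braun et al. Lemma 2.3: `C̃(f) − f(s) = tr(U^f X^s) + μ_f`, `μ_f ≥ 0`) yields for an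
`ε`-APPROXIMATE formulation without padding the size: `pmSlack U M + ε = tr(A(M) B(U)) + μ(U)` with
`μ(U) ≥ 0` on odd `U`, and the same `G`-equivariance of `M ↦ A(M)`.
[cite: BraunEtAl2016, Lemma 2.3 (p. 5)] -/
def IsSubgroupEquivariantPsdFactorizationAff (n d : ℕ) (G : Subgroup (Equiv.Perm (Fin n))) (ε : ℝ)
    (ρ : G →* GL (Fin d) ℝ) (A : Finset (Sym2 (Fin n)) → Matrix (Fin d) (Fin d) ℝ)
    (B : Finset (Fin n) → Matrix (Fin d) (Fin d) ℝ) (μ : Finset (Fin n) → ℝ) : Prop :=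
  (∀ M, IsPMOn univ M → (A M).PosSemidef) ∧ (∀ U, Odd U.card → (B U).PosSemidef) ∧
    (∀ U, Odd U.card → 0 ≤ μ U) ∧
    (∀ U M, Odd U.card → IsPMOn univ M → pmSlack U M + ε = (A M * B U).trace + μ U) ∧
    ∀ σ : G, ∀ M, IsPMOn univ M →
      A (permEdges (σ : Equiv.Perm (Fin n)) M) = (ρ σ : Matrix (Fin d) (Fin d) ℝ) * A M * (ρ σ : Matrix (Fin d) (Fin d) ℝ)ᵀ

/-- A subspace `V` of real functions on the perfect matchings of `K_n` is **`G`-invariant**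
(`G ≤ 𝔖ₙ`): `(σ·f)(M) = f(σ⁻¹·M)` stays in `V` for `σ ∈ G` (`IsPermInvariant` is the case `G = 𝔖ₙ`).
[cite: FawziSaundersonParrilo2013, §2 (p. 9) and Thm. 1 (p. 7)] -/
def IsSubgroupInvariant {n : ℕ} (G : Subgroup (Equiv.Perm (Fin n)))
    (V : Submodule ℝ (PMSol n → ℝ)) : Prop :=
  ∀ σ : G, ∀ f ∈ V, (fun M => f ((σ : Equiv.Perm (Fin n))⁻¹ • M)) ∈ V

/-- An exact factorization is an affine one with `μ = 0`. [cite: BraunEtAl2016, Lemma 2.3 (p. 5)] -/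
theorem IsSubgroupEquivariantPsdFactorization.aff {n d : ℕ} {G : Subgroup (Equiv.Perm (Fin n))}
    {ε : ℝ} {ρ : G →* GL (Fin d) ℝ} {A : Finset (Sym2 (Fin n)) → Matrix (Fin d) (Fin d) ℝ}
    {B : Finset (Fin n) → Matrix (Fin d) (Fin d) ℝ}
    (h : IsSubgroupEquivariantPsdFactorization n d G ε ρ A B) :
    IsSubgroupEquivariantPsdFactorizationAff n d G ε ρ A B (fun _ => 0) :=
  ⟨h.1, h.2.1, fun _ _ => le_rfl, fun U M hU hM => by rw [h.2.2.1 U M hU hM, add_zero], h.2.2.2⟩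

/-- An `𝔖ₙ`-equivariant psd factorization of the odd-cut slack (`IsEquivariantPsdFactorization`) is a
`⊤`-equivariant one of the `0`-shifted slack. [cite: FawziSaundersonParrilo2013, Def. 2 (p. 3)] -/
theorem IsEquivariantPsdFactorization.isSubgroupEquivariantPsdFactorization_top {n d : ℕ}
    {ρ : Equiv.Perm (Fin n) →* GL (Fin d) ℝ} {A : Finset (Sym2 (Fin n)) → Matrix (Fin d) (Fin d) ℝ}
    {B : Finset (Fin n) → Matrix (Fin d) (Fin d) ℝ} (h : IsEquivariantPsdFactorization n d ρ A B) :
    IsSubgroupEquivariantPsdFactorization n d ⊤ 0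
      (ρ.comp (⊤ : Subgroup (Equiv.Perm (Fin n))).subtype) A B := by
  obtain ⟨hA, hB, hAB, hequi⟩ := h
  refine ⟨hA, hB, fun U M hU hM => ?_, fun σ M hM => ?_⟩
  · rw [add_zero]
    exact hAB U M hU hM
  · simpa using hequi (σ : Equiv.Perm (Fin n)) M hM

/-- `HasEquivariantPsdFactorization n d` (the `𝔖ₙ` vocabulary) implies
`HasSubgroupEquivariantPsdFactorization n d ⊤ 0`: the subgroup statements below dominate the `𝔖ₙ`
ones. [cite: FawziSaundersonParrilo2013, Def. 2 (p. 3)] -/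
theorem HasEquivariantPsdFactorization.hasSubgroupEquivariantPsdFactorization_top {n d : ℕ}
    (h : HasEquivariantPsdFactorization n d) : HasSubgroupEquivariantPsdFactorization n d ⊤ 0 := by
  obtain ⟨ρ, A, B, h⟩ := h
  exact ⟨_, A, B, h.isSubgroupEquivariantPsdFactorization_top⟩

/-- An `𝔖ₙ`-invariant subspace is `G`-invariant for every `G ≤ 𝔖ₙ`.
[cite: FawziSaundersonParrilo2013, §2 (p. 9)] -/
theorem IsPermInvariant.isSubgroupInvariant {n : ℕ} {V : Submodule ℝ (PMSol n → ℝ)}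
    (h : IsPermInvariant V) (G : Subgroup (Equiv.Perm (Fin n))) : IsSubgroupInvariant G V :=
  fun σ f hf => h (σ : Equiv.Perm (Fin n)) f hf

/-- `⊤`-invariance is `𝔖ₙ`-invariance. [cite: FawziSaundersonParrilo2013, §2 (p. 9)] -/
theorem isSubgroupInvariant_top_iff {n : ℕ} (V : Submodule ℝ (PMSol n → ℝ)) :
    IsSubgroupInvariant ⊤ V ↔ IsPermInvariant V :=
  ⟨fun h σ f hf => h ⟨σ, Subgroup.mem_top σ⟩ f hf, fun h => h.isSubgroupInvariant ⊤⟩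

namespace SubgroupEquivariantPsdStructure

/-! ### Lemma 2 — the index span: a `G`-invariant subspace sits in an `𝔖ₙ`-invariant one of
dimension `≤ [𝔖ₙ : G] · dim V` (sum of the translates over a left transversal) -/

/-- `dim (⨆_{i ∈ s} P i) ≤ ∑_{i ∈ s} dim (P i)`. [folklore] -/
private theorem finrank_biSup_finset_le_sum {K W : Type*} [DivisionRing K] [AddCommGroup W] [Module K W]
    [FiniteDimensional K W] {ι : Type*} (P : ι → Submodule K W) (s : Finset ι) :
    Module.finrank K (⨆ i ∈ s, P i : Submodule K W) ≤ ∑ i ∈ s, Module.finrank K (P i) := by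
  classical
  induction s using Finset.induction_on with
  | empty => simp
  | insert a s ha ih =>
    rw [Finset.iSup_insert, Finset.sum_insert ha]
    exact (Submodule.finrank_add_le_finrank_add_finrank _ _).trans (Nat.add_le_add_left ih _)

/-- `dim (⨆ i, P i) ≤ ∑ i, dim (P i)` over a finite index type. [folklore] -/
private theorem finrank_iSup_le_sum {K W : Type*} [DivisionRing K] [AddCommGroup W] [Module K W]
    [FiniteDimensional K W] {ι : Type*} [Fintype ι] (P : ι → Submodule K W) :
    Module.finrank K (⨆ i, P i : Submodule K W) ≤ ∑ i, Module.finrank K (P i) := by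
  have h : (⨆ i, P i : Submodule K W) = ⨆ i ∈ (Finset.univ : Finset ι), P i := by simp
  rw [h]
  exact finrank_biSup_finset_le_sum P Finset.univ

/-- For a group representation, `ρ g ∘ ρ g⁻¹ = id`. [folklore] -/
private theorem rep_comp_inv_eq_id {k G W : Type*} [CommSemiring k] [Group G] [AddCommMonoid W]
    [Module k W] (ρ : Representation k G W) (g : G) :
    (ρ g).comp (ρ g⁻¹) = LinearMap.id := by
  rw [← Module.End.mul_eq_comp, ← map_mul, mul_inv_cancel, map_one, Module.End.one_eq_id]

/-- Translating a subspace by `ρ g` preserves its dimension. [folklore] -/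
private theorem finrank_map_rep_eq {k G W : Type*} [Field k] [Group G] [AddCommGroup W] [Module k W]
    (ρ : Representation k G W) (g : G) (V : Submodule k W) :
    Module.finrank k (V.map (ρ g)) = Module.finrank k V := by
  exact LinearEquiv.finrank_map_eq
    (LinearEquiv.ofLinear (ρ g) (ρ g⁻¹) (rep_comp_inv_eq_id ρ g)
      (by simpa using rep_comp_inv_eq_id ρ g⁻¹)) V

/-- Translates compose: `ρ g (ρ g' V) = ρ (g g') V`. [folklore] -/
private theorem map_rep_map_rep {k G W : Type*} [CommSemiring k] [Group G] [AddCommMonoid W] [Module k W]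
    (ρ : Representation k G W) (g g' : G) (V : Submodule k W) :
    (V.map (ρ g')).map (ρ g) = V.map (ρ (g * g')) := by
  rw [map_mul, Module.End.mul_eq_comp, Submodule.map_comp]

/-- The permutation representation of `𝔖ₙ` on real functions on the perfect matchings of `K_n`:
`(ρ σ f)(M) = f(σ⁻¹ • M)`. [cite: FawziSaundersonParrilo2013, §2 (p. 9)] -/
def permRep (n : ℕ) : Representation ℝ (Equiv.Perm (Fin n)) (PMSol n → ℝ) where
  toFun σ := LinearMap.funLeft ℝ ℝ (fun M : PMSol n => σ⁻¹ • M)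
  map_one' := by
    ext f M
    simp [LinearMap.funLeft_apply]
  map_mul' := by
    intro σ τ
    ext f M
    simp [LinearMap.funLeft_apply, mul_smul]

/-- `permRep n σ f = (M ↦ f (σ⁻¹ • M))`. [cite: FawziSaundersonParrilo2013, §2 (p. 9)] -/
theorem permRep_apply (n : ℕ) (σ : Equiv.Perm (Fin n)) (f : PMSol n → ℝ) :
    permRep n σ f = fun M => f (σ⁻¹ • M) := by
  ext M
  simp [permRep, LinearMap.funLeft_apply]

end SubgroupEquivariantPsdStructure

open SubgroupEquivariantPsdStructure in
/-- **Index span (Lemma 2 of the cell's R2-full).** A `G`-invariant subspace `V` of functions on the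
perfect matchings of `K_n` (`G ≤ 𝔖ₙ`) is contained in an `𝔖ₙ`-invariant subspace `V'` with
`dim V' ≤ [𝔖ₙ : G] · dim V`: `ρ(g)V = V` for `g ∈ G` (dimension count), so `g ↦ ρ(g)V` is constant on
left cosets and `V' = Σ_{gG ∈ 𝔖ₙ/G} ρ(g)V` works — the sum of translates over the cosets of the
induced-representation construction (Fulton–Harris §3.3: "`g·W` depends only on the left coset `gH` …
`V = ⊕_{σ ∈ G/H} σ·W`"; here the sum need not be direct, whence only `≤`). Statement = the cell's typed
`IndexSpan` (HOME/pnp-psdrank-p2/Sketch-v4-R2full.lean, verbatim).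
[cite: FultonHarrisGTM129, §3.3 (p. 32, the translates σ·W over G/H)] -/
theorem indexSpan :
    ∀ n : ℕ, ∀ (G : Subgroup (Equiv.Perm (Fin n))) (V : Submodule ℝ (PMSol n → ℝ)),
      IsSubgroupInvariant G V → ∃ V' : Submodule ℝ (PMSol n → ℝ),
        IsPermInvariant V' ∧ V ≤ V' ∧ Module.finrank ℝ V' ≤ G.index * Module.finrank ℝ V := by
  intro n G V hV
  classical
  set ρ := permRep n with hρdef
  -- `G`-invariance in representation form, then stability `ρ g V = V` for `g ∈ G`
  have hPW : ∀ g ∈ G, V.map (ρ g) ≤ V := by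
    intro g hg f hf
    obtain ⟨f', hf', rfl⟩ := Submodule.mem_map.mp hf
    rw [hρdef, permRep_apply]
    exact hV ⟨g, hg⟩ f' hf'
  have hstab : ∀ g ∈ G, V.map (ρ g) = V := fun g hg =>
    Submodule.eq_of_le_of_finrank_eq (hPW g hg) (finrank_map_rep_eq ρ g V)
  -- `g ↦ ρ g V` is constant on left cosets of `G`
  set F : (Equiv.Perm (Fin n)) ⧸ G → Submodule ℝ (PMSol n → ℝ) := fun c => V.map (ρ c.out) with hF
  have hcoset : ∀ g : Equiv.Perm (Fin n), V.map (ρ g) = F (QuotientGroup.mk g) := by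
    intro g
    obtain ⟨p, hp⟩ := QuotientGroup.mk_out_eq_mul G g
    simp only [hF]
    rw [hp, ← map_rep_map_rep, hstab _ p.2]
  -- the orbit span
  set W' : Submodule ℝ (PMSol n → ℝ) := ⨆ g : Equiv.Perm (Fin n), V.map (ρ g) with hW'
  have hW'stab : ∀ g : Equiv.Perm (Fin n), W'.map (ρ g) ≤ W' := by
    intro g
    rw [hW', Submodule.map_iSup]
    refine iSup_le fun g' => ?_
    rw [map_rep_map_rep]
    exact le_iSup (fun x : Equiv.Perm (Fin n) => V.map (ρ x)) (g * g')
  have hVle : V ≤ W' := by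
    have h1 : V.map (ρ 1) = V := by rw [map_one, Module.End.one_eq_id, Submodule.map_id]
    calc V = V.map (ρ 1) := h1.symm
      _ ≤ W' := le_iSup (fun x : Equiv.Perm (Fin n) => V.map (ρ x)) 1
  have hW'le : W' ≤ ⨆ c : (Equiv.Perm (Fin n)) ⧸ G, F c :=
    iSup_le fun g => (hcoset g).le.trans (le_iSup F (QuotientGroup.mk g))
  have hFdim : ∀ c : (Equiv.Perm (Fin n)) ⧸ G, Module.finrank ℝ (F c) = Module.finrank ℝ V :=
    fun c => finrank_map_rep_eq ρ c.out V
  refine ⟨W', ?_, hVle, ?_⟩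
  · intro σ f hf
    have h := hW'stab σ (Submodule.mem_map_of_mem hf)
    rw [hρdef, permRep_apply] at h
    exact h
  · calc Module.finrank ℝ W'
          ≤ Module.finrank ℝ (⨆ c : (Equiv.Perm (Fin n)) ⧸ G, F c : Submodule ℝ (PMSol n → ℝ)) :=
            Submodule.finrank_mono hW'le
      _ ≤ ∑ c : (Equiv.Perm (Fin n)) ⧸ G, Module.finrank ℝ (F c) := finrank_iSup_le_sum F
      _ = ∑ _c : (Equiv.Perm (Fin n)) ⧸ G, Module.finrank ℝ V := Finset.sum_congr rfl fun c _ => hFdim c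
      _ = G.index * Module.finrank ℝ V := by
        rw [Finset.sum_const, Finset.card_univ, smul_eq_mul, Subgroup.index_eq_card,
          Nat.card_eq_fintype_card]

namespace SubgroupEquivariantPsdStructure

/-! ### Lemma 1 — orthogonalising the representation over `G` (FSP Prop. 2) -/

open scoped MatrixOrder
open Literature.Combinatorics.Optimization.EquivariantPsdStructure

variable {n d : ℕ} {G : Subgroup (Equiv.Perm (Fin n))} [Fintype G] (ρ : G →* GL (Fin d) ℝ)

/-- `P = Σ_{σ ∈ G} ρ(σ)ᴴ ρ(σ)`. [cite: FawziSaundersonParrilo2013, Prop. 2 (p. 9)] -/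
def gramG : Matrix (Fin d) (Fin d) ℝ :=
  ∑ σ : G, (ρ σ : Matrix (Fin d) (Fin d) ℝ)ᴴ * (ρ σ : Matrix (Fin d) (Fin d) ℝ)

/-- `P ≻ 0`. [cite: FawziSaundersonParrilo2013, Prop. 2 (p. 9)] -/
theorem gramG_posDef : (gramG ρ).PosDef := by
  classical
  rw [gramG, ← Finset.add_sum_erase _ _ (mem_univ (1 : G))]
  have h1 : ((ρ 1 : GL (Fin d) ℝ) : Matrix (Fin d) (Fin d) ℝ)ᴴ * (ρ 1 : Matrix (Fin d) (Fin d) ℝ) = 1 := by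
    rw [map_one, Units.val_one, conjTranspose_one, Matrix.mul_one]
  rw [h1]
  exact PosDef.one.add_posSemidef
    (posSemidef_sum _ fun σ _ => posSemidef_conjTranspose_mul_self _)

/-- `ρ(τ)ᴴ P ρ(τ) = P` for `τ ∈ G`. [cite: FawziSaundersonParrilo2013, Prop. 2 (p. 9)] -/
theorem conj_gramG (τ : G) :
    (ρ τ : Matrix (Fin d) (Fin d) ℝ)ᴴ * gramG ρ * (ρ τ : Matrix (Fin d) (Fin d) ℝ) = gramG ρ := by
  rw [gramG, Finset.mul_sum, Finset.sum_mul]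
  have h : ∀ σ : G,
      (ρ τ : Matrix (Fin d) (Fin d) ℝ)ᴴ * ((ρ σ : Matrix (Fin d) (Fin d) ℝ)ᴴ * (ρ σ : Matrix (Fin d) (Fin d) ℝ)) *
        (ρ τ : Matrix (Fin d) (Fin d) ℝ) =
      (ρ (σ * τ) : Matrix (Fin d) (Fin d) ℝ)ᴴ * (ρ (σ * τ) : Matrix (Fin d) (Fin d) ℝ) := by
    intro σ
    rw [map_mul, Units.val_mul, conjTranspose_mul]
    simp only [Matrix.mul_assoc]
  simp_rw [h]
  exact Fintype.sum_equiv (Equiv.mulRight τ) _ _ fun σ => rfl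

/-- `R = P^{1/2}`. [cite: FawziSaundersonParrilo2013, Prop. 2 (p. 9)] -/
def sqrtGramG : Matrix (Fin d) (Fin d) ℝ := CFC.sqrt (gramG ρ)

/-- `Rᴴ = R`. [cite: FawziSaundersonParrilo2013, Prop. 2 (p. 9)] -/
theorem sqrtGramG_conjTranspose : (sqrtGramG ρ)ᴴ = sqrtGramG ρ :=
  (CFC.sqrt_nonneg (gramG ρ)).posSemidef.1

/-- `R R = P`. [cite: FawziSaundersonParrilo2013, Prop. 2 (p. 9)] -/
theorem sqrtGramG_mul_self : sqrtGramG ρ * sqrtGramG ρ = gramG ρ :=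
  CFC.sqrt_mul_sqrt_self _ (gramG_posDef ρ).posSemidef.nonneg

/-- `R` is invertible. [cite: FawziSaundersonParrilo2013, Prop. 2 (p. 9)] -/
theorem isUnit_det_sqrtGramG : IsUnit (sqrtGramG ρ).det := by
  rw [isUnit_iff_ne_zero, sqrtGramG, PosSemidef.det_sqrt (gramG_posDef ρ).posSemidef, RCLike.sqrt_real]
  exact Real.sqrt_ne_zero'.2 (gramG_posDef ρ).det_pos

/-- `R R⁻¹ = 1`. [cite: FawziSaundersonParrilo2013, Prop. 2 (p. 9)] -/
theorem sqrtGramG_mul_inv : sqrtGramG ρ * (sqrtGramG ρ)⁻¹ = 1 :=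
  Matrix.mul_nonsing_inv _ (isUnit_det_sqrtGramG ρ)

/-- `R⁻¹ R = 1`. [cite: FawziSaundersonParrilo2013, Prop. 2 (p. 9)] -/
theorem inv_mul_sqrtGramG : (sqrtGramG ρ)⁻¹ * sqrtGramG ρ = 1 :=
  Matrix.nonsing_inv_mul _ (isUnit_det_sqrtGramG ρ)

/-- `(R⁻¹)ᴴ = R⁻¹`. [cite: FawziSaundersonParrilo2013, Prop. 2 (p. 9)] -/
theorem inv_sqrtGramG_conjTranspose : ((sqrtGramG ρ)⁻¹)ᴴ = (sqrtGramG ρ)⁻¹ := by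
  rw [conjTranspose_nonsing_inv, sqrtGramG_conjTranspose]

/-- The orthogonalised representation `ρ'(σ) = R ρ(σ) R⁻¹`, `σ ∈ G`.
[cite: FawziSaundersonParrilo2013, Prop. 2 (p. 9)] -/
def orthG (σ : G) : Matrix (Fin d) (Fin d) ℝ :=
  sqrtGramG ρ * (ρ σ : Matrix (Fin d) (Fin d) ℝ) * (sqrtGramG ρ)⁻¹

/-- `ρ'(σ)ᴴ = R⁻¹ ρ(σ)ᴴ R`. [cite: FawziSaundersonParrilo2013, Prop. 2 (p. 9)] -/
theorem orthG_conjTranspose (σ : G) :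
    (orthG ρ σ)ᴴ = (sqrtGramG ρ)⁻¹ * (ρ σ : Matrix (Fin d) (Fin d) ℝ)ᴴ * sqrtGramG ρ := by
  rw [orthG, conjTranspose_mul, conjTranspose_mul, inv_sqrtGramG_conjTranspose, sqrtGramG_conjTranspose,
    Matrix.mul_assoc]

/-- **`ρ'` is orthogonal**: `ρ'(σ)ᴴ ρ'(σ) = 1`. [cite: FawziSaundersonParrilo2013, Prop. 2 (p. 9)] -/
theorem orthG_conjTranspose_mul_self (σ : G) : (orthG ρ σ)ᴴ * orthG ρ σ = 1 := by
  rw [orthG_conjTranspose, orthG]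
  calc (sqrtGramG ρ)⁻¹ * (ρ σ : Matrix (Fin d) (Fin d) ℝ)ᴴ * sqrtGramG ρ *
        (sqrtGramG ρ * (ρ σ : Matrix (Fin d) (Fin d) ℝ) * (sqrtGramG ρ)⁻¹)
      = (sqrtGramG ρ)⁻¹ * ((ρ σ : Matrix (Fin d) (Fin d) ℝ)ᴴ * (sqrtGramG ρ * sqrtGramG ρ) *
          (ρ σ : Matrix (Fin d) (Fin d) ℝ)) * (sqrtGramG ρ)⁻¹ := by simp only [Matrix.mul_assoc]
    _ = (sqrtGramG ρ)⁻¹ * (sqrtGramG ρ * sqrtGramG ρ) * (sqrtGramG ρ)⁻¹ := by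
          rw [sqrtGramG_mul_self, conj_gramG]
    _ = 1 := by
          rw [Matrix.mul_assoc, Matrix.mul_assoc, sqrtGramG_mul_inv, Matrix.mul_one, inv_mul_sqrtGramG]

/-! ### The conjugated factorization and its square root -/

variable (A : Finset (Sym2 (Fin n)) → Matrix (Fin d) (Fin d) ℝ)

/-- `A'(M) = R A(M) R`. [cite: FawziSaundersonParrilo2013, Thm. 4 (proof, p. 11)] -/
def conjAG (M : Finset (Sym2 (Fin n))) : Matrix (Fin d) (Fin d) ℝ := sqrtGramG ρ * A M * sqrtGramG ρ

/-- `Q(M) = A'(M)^{1/2}`. [cite: FawziSaundersonParrilo2013, Thm. 4 (proof, p. 11, "A(x)^{1/2}")] -/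
def sqrtAG (M : Finset (Sym2 (Fin n))) : Matrix (Fin d) (Fin d) ℝ := CFC.sqrt (conjAG ρ A M)

variable {ρ A}

/-- `A'(M) ⪰ 0` on perfect matchings. [cite: FawziSaundersonParrilo2013, Thm. 4 (proof, p. 11)] -/
theorem conjAG_posSemidef (hA : ∀ M : Finset (Sym2 (Fin n)), IsPMOn univ M → (A M).PosSemidef)
    {M : Finset (Sym2 (Fin n))} (hM : IsPMOn univ M) : (conjAG ρ A M).PosSemidef := by
  have := (hA M hM).mul_mul_conjTranspose_same (sqrtGramG ρ)
  rwa [sqrtGramG_conjTranspose] at this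

/-- **Equivariance of `A'`** under the orthogonal `ρ'` (for `σ ∈ G`).
[cite: FawziSaundersonParrilo2013, Thm. 4 (proof, p. 11)] -/
theorem conjAG_perm
    (hEq : ∀ σ : G, ∀ M : Finset (Sym2 (Fin n)), IsPMOn univ M →
      A (permEdges (σ : Equiv.Perm (Fin n)) M) = (ρ σ : Matrix (Fin d) (Fin d) ℝ) * A M * (ρ σ : Matrix (Fin d) (Fin d) ℝ)ᵀ) (σ : G)
    {M : Finset (Sym2 (Fin n))} (hM : IsPMOn univ M) :
    conjAG ρ A (permEdges (σ : Equiv.Perm (Fin n)) M) = orthG ρ σ * conjAG ρ A M * (orthG ρ σ)ᴴ := by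
  rw [conjAG, hEq σ M hM, ← conjTranspose_eq_transpose, orthG_conjTranspose, orthG, conjAG]
  symm
  calc sqrtGramG ρ * (ρ σ : Matrix (Fin d) (Fin d) ℝ) * (sqrtGramG ρ)⁻¹ * (sqrtGramG ρ * A M * sqrtGramG ρ) *
        ((sqrtGramG ρ)⁻¹ * (ρ σ : Matrix (Fin d) (Fin d) ℝ)ᴴ * sqrtGramG ρ)
      = sqrtGramG ρ * (ρ σ : Matrix (Fin d) (Fin d) ℝ) * ((sqrtGramG ρ)⁻¹ * sqrtGramG ρ) * A M *
          (sqrtGramG ρ * (sqrtGramG ρ)⁻¹) * (ρ σ : Matrix (Fin d) (Fin d) ℝ)ᴴ * sqrtGramG ρ := by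
          simp only [Matrix.mul_assoc]
    _ = sqrtGramG ρ * ((ρ σ : Matrix (Fin d) (Fin d) ℝ) * A M * (ρ σ : Matrix (Fin d) (Fin d) ℝ)ᴴ) *
          sqrtGramG ρ := by
          rw [inv_mul_sqrtGramG, sqrtGramG_mul_inv, Matrix.mul_one, Matrix.mul_one]
          simp only [Matrix.mul_assoc]

/-- **Equivariance of the square root `Q`** (uniqueness of the psd square root).
[cite: FawziSaundersonParrilo2013, Thm. 4 (proof, p. 11)] -/
theorem sqrtAG_perm (hA : ∀ M : Finset (Sym2 (Fin n)), IsPMOn univ M → (A M).PosSemidef)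
    (hEq : ∀ σ : G, ∀ M : Finset (Sym2 (Fin n)), IsPMOn univ M →
      A (permEdges (σ : Equiv.Perm (Fin n)) M) = (ρ σ : Matrix (Fin d) (Fin d) ℝ) * A M * (ρ σ : Matrix (Fin d) (Fin d) ℝ)ᵀ) (σ : G)
    {M : Finset (Sym2 (Fin n))} (hM : IsPMOn univ M) :
    sqrtAG ρ A (permEdges (σ : Equiv.Perm (Fin n)) M) = orthG ρ σ * sqrtAG ρ A M * (orthG ρ σ)ᴴ := by
  rw [sqrtAG, conjAG_perm hEq σ hM, sqrt_conj (conjAG_posSemidef hA hM) (orthG_conjTranspose_mul_self ρ σ),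
    sqrtAG]

/-- `Qᴴ = Q`. [cite: FawziSaundersonParrilo2013, Thm. 4 (proof, p. 11)] -/
theorem sqrtAG_conjTranspose (M : Finset (Sym2 (Fin n))) : (sqrtAG ρ A M)ᴴ = sqrtAG ρ A M :=
  (CFC.sqrt_nonneg _).posSemidef.1

/-- `Q Q = A'` on perfect matchings. [cite: FawziSaundersonParrilo2013, Thm. 4 (proof, p. 11)] -/
theorem sqrtAG_mul_self (hA : ∀ M : Finset (Sym2 (Fin n)), IsPMOn univ M → (A M).PosSemidef)
    {M : Finset (Sym2 (Fin n))} (hM : IsPMOn univ M) : sqrtAG ρ A M * sqrtAG ρ A M = conjAG ρ A M :=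
  CFC.sqrt_mul_sqrt_self _ (conjAG_posSemidef hA hM).nonneg

/-! ### The invariant subspace spanned by the entries of `Q` -/

variable (ρ A)

/-- The entry functions `M ↦ Q(M)_{pq}` on perfect matchings.
[cite: FawziSaundersonParrilo2013, Thm. 4 (proof, p. 11)] -/
def entryFnG (pq : Fin d × Fin d) : PMSol n → ℝ := fun M => sqrtAG ρ A M.1 pq.1 pq.2

/-- `V = span {M ↦ Q(M)_{pq}}`. [cite: FawziSaundersonParrilo2013, Thm. 1 (p. 7, "a G-invariant subspace V")] -/
def entrySpanG : Submodule ℝ (PMSol n → ℝ) := Submodule.span ℝ (Set.range (entryFnG ρ A))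

/-- `dim V ≤ d²`. [cite: FawziSaundersonParrilo2013, Thm. 1 (p. 7)] -/
theorem finrank_entrySpanG_le : Module.finrank ℝ (entrySpanG ρ A) ≤ d ^ 2 := by
  refine (finrank_range_le_card _).trans ?_
  rw [Fintype.card_prod, Fintype.card_fin, sq]

variable {ρ A}

/-- A linear combination of entry functions lies in `V`. [cite: FawziSaundersonParrilo2013, Thm. 4 (proof, p. 11)] -/
theorem sum_smul_entryFnG_mem (c : Fin d × Fin d → ℝ) :
    (fun M : PMSol n => ∑ rs : Fin d × Fin d, c rs * sqrtAG ρ A M.1 rs.1 rs.2) ∈ entrySpanG ρ A := by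
  have : (fun M : PMSol n => ∑ rs : Fin d × Fin d, c rs * sqrtAG ρ A M.1 rs.1 rs.2) =
      ∑ rs : Fin d × Fin d, c rs • entryFnG ρ A rs := by
    funext M
    simp only [Finset.sum_apply, Pi.smul_apply, smul_eq_mul, entryFnG]
  rw [this]
  exact Submodule.sum_mem _ fun rs _ => Submodule.smul_mem _ _ (Submodule.subset_span ⟨rs, rfl⟩)

/-- **`V` is `G`-invariant.** [cite: FawziSaundersonParrilo2013, Thm. 4 (proof, p. 11)] -/
theorem isSubgroupInvariant_entrySpanG (hA : ∀ M : Finset (Sym2 (Fin n)), IsPMOn univ M → (A M).PosSemidef)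
    (hEq : ∀ σ : G, ∀ M : Finset (Sym2 (Fin n)), IsPMOn univ M →
      A (permEdges (σ : Equiv.Perm (Fin n)) M) = (ρ σ : Matrix (Fin d) (Fin d) ℝ) * A M * (ρ σ : Matrix (Fin d) (Fin d) ℝ)ᵀ) :
    IsSubgroupInvariant G (entrySpanG ρ A) := by
  intro σ f hf
  let L : (PMSol n → ℝ) →ₗ[ℝ] (PMSol n → ℝ) :=
    LinearMap.funLeft ℝ ℝ fun M : PMSol n => (σ : Equiv.Perm (Fin n))⁻¹ • M
  change L f ∈ entrySpanG ρ A
  have hgen : Set.range (entryFnG ρ A) ⊆ (entrySpanG ρ A).comap L := by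
    rintro _ ⟨⟨p, q⟩, rfl⟩
    change (fun M : PMSol n => sqrtAG ρ A ((σ : Equiv.Perm (Fin n))⁻¹ • M).1 p q) ∈ entrySpanG ρ A
    have hfun : (fun M : PMSol n => sqrtAG ρ A ((σ : Equiv.Perm (Fin n))⁻¹ • M).1 p q) = fun M : PMSol n =>
        ∑ rs : Fin d × Fin d, (orthG ρ σ⁻¹ p rs.1 * orthG ρ σ⁻¹ q rs.2) * sqrtAG ρ A M.1 rs.1 rs.2 := by
      funext M
      have hval : ((σ : Equiv.Perm (Fin n))⁻¹ • M).1 = permEdges ((σ⁻¹ : G) : Equiv.Perm (Fin n)) M.1 := by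
        rw [Subgroup.coe_inv]; rfl
      rw [hval, sqrtAG_perm hA hEq σ⁻¹ M.2, Matrix.mul_apply, Fintype.sum_prod_type]
      simp only [Matrix.mul_apply, conjTranspose_apply, star_trivial, Finset.sum_mul]
      rw [Finset.sum_comm]
      refine Finset.sum_congr rfl fun r _ => Finset.sum_congr rfl fun s _ => ?_
      ring
    rw [hfun]
    exact sum_smul_entryFnG_mem _
  exact (Submodule.span_le.2 hgen) hf

/-- **Core of the structure theorem, per odd set**: for `B_U ⪰ 0`, `tr(A(M) B_U) = Σ_j g_j(M)²` on
perfect matchings with all `g_j ∈ V` (`B' = R⁻¹ B_U R⁻¹`, `S = (B')^{1/2}`,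
`g_{(p,i)}(M) = (Q(M) S)_{pi}`). The target matrix never enters, so the same lemma serves the exact,
the `ε`-shifted and the affine factorizations. [cite: FawziSaundersonParrilo2013, Thm. 4 (proof, pp. 10–11)] -/
theorem sos_of_trace (hA : ∀ M : Finset (Sym2 (Fin n)), IsPMOn univ M → (A M).PosSemidef) {BU : Matrix (Fin d) (Fin d) ℝ}
    (hBU : BU.PosSemidef) :
    ∃ (s : ℕ) (g : Fin s → (PMSol n → ℝ)), (∀ j, g j ∈ entrySpanG ρ A) ∧
      ∀ M : PMSol n, (A M.1 * BU).trace = ∑ j, (g j M) ^ 2 := by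
  classical
  set B' := (sqrtGramG ρ)⁻¹ * BU * (sqrtGramG ρ)⁻¹ with hB'
  have hB'psd : B'.PosSemidef := by
    have := hBU.mul_mul_conjTranspose_same (sqrtGramG ρ)⁻¹
    rwa [inv_sqrtGramG_conjTranspose] at this
  set S := CFC.sqrt B' with hS
  have hSS : S * S = B' := CFC.sqrt_mul_sqrt_self _ hB'psd.nonneg
  have hSherm : Sᴴ = S := (CFC.sqrt_nonneg B').posSemidef.1
  let e : Fin (d * d) ≃ Fin d × Fin d := finProdFinEquiv.symm
  refine ⟨d * d, fun j M => (sqrtAG ρ A M.1 * S) (e j).1 (e j).2, fun j => ?_, fun M => ?_⟩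
  · have hfun : (fun M : PMSol n => (sqrtAG ρ A M.1 * S) (e j).1 (e j).2) =
        ∑ q : Fin d, S q (e j).2 • entryFnG ρ A ((e j).1, q) := by
      funext M
      simp only [Matrix.mul_apply, Finset.sum_apply, Pi.smul_apply, smul_eq_mul, entryFnG]
      exact Finset.sum_congr rfl fun q _ => mul_comm _ _
    change (fun M : PMSol n => (sqrtAG ρ A M.1 * S) (e j).1 (e j).2) ∈ entrySpanG ρ A
    rw [hfun]
    exact Submodule.sum_mem _ fun q _ => Submodule.smul_mem _ _ (Submodule.subset_span ⟨_, rfl⟩)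
  · have htr : (A M.1 * BU).trace = (conjAG ρ A M.1 * B').trace := by
      rw [conjAG, hB']
      calc (A M.1 * BU).trace
          = (A M.1 * BU * ((sqrtGramG ρ)⁻¹ * sqrtGramG ρ)).trace := by rw [inv_mul_sqrtGramG, Matrix.mul_one]
        _ = (sqrtGramG ρ * (A M.1 * BU * (sqrtGramG ρ)⁻¹)).trace := by
              rw [← Matrix.mul_assoc, Matrix.trace_mul_comm]
        _ = (sqrtGramG ρ * A M.1 * sqrtGramG ρ * ((sqrtGramG ρ)⁻¹ * BU * (sqrtGramG ρ)⁻¹)).trace := by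
              congr 1
              calc sqrtGramG ρ * (A M.1 * BU * (sqrtGramG ρ)⁻¹)
                  = sqrtGramG ρ * A M.1 * (1 : Matrix (Fin d) (Fin d) ℝ) * BU * (sqrtGramG ρ)⁻¹ := by
                      rw [Matrix.mul_one]; simp only [Matrix.mul_assoc]
                _ = sqrtGramG ρ * A M.1 * sqrtGramG ρ * ((sqrtGramG ρ)⁻¹ * BU * (sqrtGramG ρ)⁻¹) := by
                      rw [← sqrtGramG_mul_inv ρ]; simp only [Matrix.mul_assoc]
    rw [htr, ← sqrtAG_mul_self hA M.2, ← hSS, trace_mul_mul_eq_sum_sq (sqrtAG_conjTranspose _) hSherm,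
      ← Fintype.sum_prod_type', ← Fintype.sum_equiv e _ _ fun j => rfl]

end SubgroupEquivariantPsdStructure

open SubgroupEquivariantPsdStructure in
/-- **FSP structure theorem for a subgroup `G ≤ 𝔖ₙ` and the shifted slack (Lemma 1 of the cell's
R2-full; generalises `equivariantStructureSq` from `𝔖ₙ`/exact slack).** A `G`-equivariant psd
factorization of size `d` of the `ε`-shifted odd-cut slack matrix of `P_PM(K_n)` yields a `G`-invariant
subspace `V` of functions on the perfect matchings with `dim V ≤ d²` such that every shifted odd-cut
slack `pmSlack U · + ε` (`U` odd) is a finite sum of squares of elements of `V`. Statement = the cell's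
typed `SubgroupStructureSq` (HOME/pnp-psdrank-p2/Sketch-v4-R2full.lean, verbatim); print has `d³` and
an arbitrary finite `G` (Thm. 1), the `d²` comes from routing the proof of Thm. 4 through the psd square
root. [cite: FawziSaundersonParrilo2013, Thm. 1 (p. 7), Prop. 2 (p. 9) and Thm. 4 (proof, pp. 10–11)] -/
theorem subgroupStructureSq :
    ∀ n d : ℕ, ∀ (G : Subgroup (Equiv.Perm (Fin n))) (ε : ℝ) (ρ : G →* GL (Fin d) ℝ)
      (A : Finset (Sym2 (Fin n)) → Matrix (Fin d) (Fin d) ℝ) (B : Finset (Fin n) → Matrix (Fin d) (Fin d) ℝ),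
      IsSubgroupEquivariantPsdFactorization n d G ε ρ A B →
        ∃ V : Submodule ℝ (PMSol n → ℝ), IsSubgroupInvariant G V ∧ Module.finrank ℝ V ≤ d ^ 2 ∧
          ∀ U : Finset (Fin n), Odd U.card → ∃ (s : ℕ) (g : Fin s → (PMSol n → ℝ)),
            (∀ j, g j ∈ V) ∧ ∀ M : PMSol n, pmSlack U M.1 + ε = ∑ j, (g j M) ^ 2 := by
  intro n d G ε ρ A B h
  classical
  letI : Fintype G := Fintype.ofFinite G
  refine ⟨entrySpanG ρ A, isSubgroupInvariant_entrySpanG h.1 h.2.2.2, finrank_entrySpanG_le ρ A,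
    fun U hU => ?_⟩
  obtain ⟨s, g, hg, hsum⟩ := sos_of_trace (ρ := ρ) (A := A) h.1 (h.2.1 U hU)
  exact ⟨s, g, hg, fun M => by rw [h.2.2.1 U M.1 hU M.2, hsum M]⟩

open SubgroupEquivariantPsdStructure in
/-- **FSP structure theorem, affine form** (the factorization theorem's constant `μ_U ≥ 0` kept as an
extra summand — what an `ε`-approximate SDP formulation hands us, Braun et al. Lemma 2.3): a
`G`-equivariant affine psd factorization of size `d` yields a `G`-invariant `V`, `dim V ≤ d²`, with
`pmSlack U M + ε = Σ_j g_j(M)² + μ_U`, all `g_j ∈ V`.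
[cite: FawziSaundersonParrilo2013, Thm. 4 (proof, pp. 10–11)] [cite: BraunEtAl2016, Lemma 2.3 (p. 5)] -/
theorem subgroupStructureSqAff (n d : ℕ) (G : Subgroup (Equiv.Perm (Fin n))) (ε : ℝ)
    (ρ : G →* GL (Fin d) ℝ) (A : Finset (Sym2 (Fin n)) → Matrix (Fin d) (Fin d) ℝ)
    (B : Finset (Fin n) → Matrix (Fin d) (Fin d) ℝ) (μ : Finset (Fin n) → ℝ)
    (h : IsSubgroupEquivariantPsdFactorizationAff n d G ε ρ A B μ) :
    ∃ V : Submodule ℝ (PMSol n → ℝ), IsSubgroupInvariant G V ∧ Module.finrank ℝ V ≤ d ^ 2 ∧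
      ∀ U : Finset (Fin n), Odd U.card → ∃ (s : ℕ) (g : Fin s → (PMSol n → ℝ)),
        (∀ j, g j ∈ V) ∧ ∀ M : PMSol n, pmSlack U M.1 + ε = (∑ j, (g j M) ^ 2) + μ U := by
  classical
  letI : Fintype G := Fintype.ofFinite G
  refine ⟨entrySpanG ρ A, isSubgroupInvariant_entrySpanG h.1 h.2.2.2.2, finrank_entrySpanG_le ρ A,
    fun U hU => ?_⟩
  obtain ⟨s, g, hg, hsum⟩ := sos_of_trace (ρ := ρ) (A := A) h.1 (h.2.1 U hU)
  exact ⟨s, g, hg, fun M => by rw [h.2.2.2.1 U M.1 hU M.2, hsum M]⟩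

end Literature.Combinatorics.Optimization

end
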